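import Mathlib.Analysis.Calculus.Deriv.Inv
import Mathlib.Topology.Algebra.Module.Determinant
import Literature.NumberTheory.Transcendental.BoundedPeriodComputable
import HarnessLib

/-!
# Real periods are finite sums of integrals over bounded domains (compact-domain reduction)

A real Kontsevich–Zagier period in the naive sense of
`Literature.NumberTheory.Transcendental.IsRealPeriod`
is an absolutely convergent integral `∫_σ p/q` of a rational function with rational coefficients
over a `ℚ`-semialgebraic `σ ⊆ ℝⁿ`; the domain `σ` and the integrand may both be unbounded.
Viu-Sos [Viu-Sos 2021, §2.2, Thm. 2.1 and Cor. 2.1 of arXiv:1509.01097] removes the first source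
of non-compactness: covering `ℙⁿ(ℝ)` by `n + 1` cubes and changing charts, every such integral is
a finite sum of absolutely convergent integrals of rational functions over *bounded* semialgebraic
sets. This file proves that reduction for the naive `ℚ`-data, with a cube-adapted variant of the
charts that keeps everything inside Mathlib's change-of-variables formula on `Fin n → ℝ`:

* off the null set `⋃ᵢ {|yᵢ| = 1}`, `ℝⁿ` is the disjoint union of the `2ⁿ` *outer regions*
  `outer T = {|yᵢ| > 1 (i ∈ T), |yᵢ| < 1 (i ∉ T)}`, `T ⊆ Fin n`;
* the coordinate inversion `inv T : yᵢ ↦ 1/yᵢ (i ∈ T)` is an involutive chart from the bounded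
  *inner region* `inner T ⊆ [-1, 1]ⁿ` onto `outer T`, with Jacobian `∏_{i ∈ T} vᵢ⁻²`
  (`abs_det_invDeriv`), and it pulls rational functions with rational coefficients back to
  rational functions with rational coefficients (`reflect`, `aeval_reflect`: clear denominators
  by `∏_{i ∈ T} vᵢ^D`);
* hence (`setIntegral_eq_sum_integral_piece`)
  `∫_σ p/q = ∑_T ∫_{pieceDom T σ} pieceNum T p q / pieceDen T p q`, each piece being KZ-literal
  data on a bounded `ℚ`-semialgebraic domain (`IsRealPeriod.exists_eq_sum_setIntegral_bounded`,
  `IsRealPeriod.exists_eq_sum_value_bounded`).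

Consequence for Yoshinaga's theorem (`isComputableReal_of_isRealPeriod`,
`isComputableComplex_of_isPeriod` of `PeriodConjecture.lean`): combined with
`BoundedPeriodComputable.lean` (bounded domain *and* bounded integrand ⇒ computable value), both
named facts now follow from the single remaining analytic input, *separation of poles on bounded
domains* [Viu-Sos 2021, Prop. 2.2 / Cor. 2.2: by Hironaka's embedded resolution of
`∂_z S ∪ {P = 0} ∪ {Q = 0}`, an absolutely convergent `∫_S P/Q` over a compact semialgebraic `S`
is a finite sum of integrals of rational functions *without poles* on compact semialgebraic
domains], which is taken here as an explicit hypothesis and is NOT vendored as a named fact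
(`isComputableReal_of_isRealPeriod_of_separationOfPoles`,
`isComputableComplex_of_isPeriod_of_separationOfPoles`).

## References

* J. Viu-Sos, *A semi-canonical reduction for periods of Kontsevich–Zagier*, Int. J. Number
  Theory 17 (2021) 147–174, arXiv:1509.01097: §2.2 (Prop. 2.1, Thm. 2.1, Cor. 2.1), §2.3
  (Thm. 2.2 = Hironaka, Prop. 2.2, Cor. 2.2, Cor. 2.3).
* M. Yoshinaga, *Periods and elementary real numbers*, arXiv:0805.0349 (2008), §3.2, Lemma 24.
* M. Kontsevich, D. Zagier, *Periods* (2001), §1.1.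
* J. Bochnak, M. Coste, M.-F. Roy, *Real Algebraic Geometry* (1998), §2.1.

## Design notes

* No Tarski–Seidenberg is needed for the pulled-back domains: `inner T ∩ (inv T)⁻¹(σ)` is
  handled generator-by-generator by clearing denominators with an *even* power
  (`isSemialgebraic_inner_inter_preimage`).
* The chart differs from Viu-Sos' (who inverts one coordinate `xᵢ` and rescales the others by
  `xⱼ/xᵢ`): inverting every large coordinate separately has a diagonal derivative, so the Jacobian
  is the elementary `ContinuousLinearMap.det_pi`; the output (finitely many absolutely convergent
  rational integrals over bounded `ℚ`-semialgebraic sets) is the same statement.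
* The definitions of this file (`inv`, `outer`, `inner`, `invDeriv`, `reflectExp`, `reflect`,
  `pieceDom`, `degBound`, `pieceNum`, `pieceDen`) are bookkeeping for the proof; no new named
  fact is introduced (D-0026), the remaining input being an explicit hypothesis.
-/

noncomputable section

open MeasureTheory Set MvPolynomial Metric Filter Topology
open scoped ENNReal
open Literature.ModelTheory.ExponentialFields

namespace Literature.NumberTheory.Transcendental

namespace PeriodCompactify

variable {n : ℕ}

/-- Inversion `y ↦ 1/y` of the coordinates in `T`, the other coordinates unchanged: the change of
chart of Viu-Sos' compactification, one coordinate direction at a time.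
[cite: Viusos2020, Thm. 2.1 (arXiv:1509.01097 numbering)] -/
def inv (T : Finset (Fin n)) (v : Fin n → ℝ) : Fin n → ℝ :=
  fun i => if i ∈ T then (v i)⁻¹ else v i

/-- The *outer region* attached to `T`: `|y i| > 1` for `i ∈ T` and `|y i| < 1` for `i ∉ T`.
[cite: Viusos2020, Thm. 2.1 (arXiv:1509.01097 numbering)] -/
def outer (T : Finset (Fin n)) : Set (Fin n → ℝ) :=
  {y | (∀ i ∈ T, 1 < |y i|) ∧ ∀ i ∉ T, |y i| < 1}

/-- The *inner region* attached to `T`: `0 < |v i| < 1` for `i ∈ T` and `|v i| < 1` for `i ∉ T`;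
the image of `outer T` under `inv T`, a subset of the cube `[-1, 1]ⁿ`.
[cite: Viusos2020, Thm. 2.1 (arXiv:1509.01097 numbering)] -/
def inner (T : Finset (Fin n)) : Set (Fin n → ℝ) :=
  {v | (∀ i ∈ T, 0 < |v i| ∧ |v i| < 1) ∧ ∀ i ∉ T, |v i| < 1}

variable (T : Finset (Fin n))

/-- `inv T` inverts the coordinates in `T`. [folklore] -/
@[simp] theorem inv_apply_of_mem {i : Fin n} (hi : i ∈ T) (v : Fin n → ℝ) :
    inv T v i = (v i)⁻¹ := by simp [inv, hi]

/-- `inv T` fixes the coordinates outside `T`. [folklore] -/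
@[simp] theorem inv_apply_of_not_mem {i : Fin n} (hi : i ∉ T) (v : Fin n → ℝ) :
    inv T v i = v i := by simp [inv, hi]

/-- `inv T` is an involution. [folklore] -/
theorem inv_inv (v : Fin n → ℝ) : inv T (inv T v) = v := by
  funext i
  by_cases hi : i ∈ T <;> simp [inv, hi]

/-- `inv T` is injective (it is an involution). [folklore] -/
theorem inv_injective : Function.Injective (inv T : (Fin n → ℝ) → Fin n → ℝ) :=
  Function.LeftInverse.injective (inv_inv T)

/-- `inv T` maps the inner region into the outer region (`0 < |v| < 1 ⇒ |1/v| > 1`).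
[cite: Viusos2020, Thm. 2.1 (arXiv:1509.01097 numbering)] -/
theorem mapsTo_inv_inner : MapsTo (inv T) (inner T) (outer T) := by
  intro v hv
  refine ⟨fun i hi => ?_, fun i hi => ?_⟩
  · obtain ⟨h0, h1⟩ := hv.1 i hi
    rw [inv_apply_of_mem T hi, abs_inv]
    exact one_lt_inv₀ h0 |>.2 h1
  · rw [inv_apply_of_not_mem T hi]
    exact hv.2 i hi

/-- `inv T` maps the outer region into the inner region (`|y| > 1 ⇒ 0 < |1/y| < 1`).
[cite: Viusos2020, Thm. 2.1 (arXiv:1509.01097 numbering)] -/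
theorem mapsTo_inv_outer : MapsTo (inv T) (outer T) (inner T) := by
  intro y hy
  refine ⟨fun i hi => ?_, fun i hi => ?_⟩
  · have h1 := hy.1 i hi
    have h0 : 0 < |y i| := one_pos.trans h1
    rw [inv_apply_of_mem T hi, abs_inv]
    exact ⟨inv_pos.2 h0, inv_lt_one_of_one_lt₀ h1⟩
  · rw [inv_apply_of_not_mem T hi]
    exact hy.2 i hi

/-- The chart property: `inv T` maps `inner T ∩ (inv T)⁻¹(σ)` onto `σ ∩ outer T`.
[cite: Viusos2020, Thm. 2.1 (arXiv:1509.01097 numbering)] -/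
theorem image_inv_inter (σ : Set (Fin n → ℝ)) :
    inv T '' (inner T ∩ inv T ⁻¹' σ) = σ ∩ outer T := by
  ext y
  constructor
  · rintro ⟨v, ⟨hv, hvσ⟩, rfl⟩
    exact ⟨hvσ, mapsTo_inv_inner T hv⟩
  · rintro ⟨hyσ, hy⟩
    exact ⟨inv T y, ⟨mapsTo_inv_outer T hy, by simpa [inv_inv] using hyσ⟩, inv_inv T y⟩

/-- Points of the inner region have non-zero coordinates in `T`. [folklore] -/
theorem ne_zero_of_mem_inner {v : Fin n → ℝ} (hv : v ∈ inner T) {i : Fin n} (hi : i ∈ T) :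
    v i ≠ 0 :=
  abs_pos.1 (hv.1 i hi).1

/-- The inner region lies in the cube `[-1, 1]ⁿ`.
[cite: Viusos2020, Thm. 2.1 (arXiv:1509.01097 numbering)] -/
theorem inner_subset_Icc : inner T ⊆ Icc (-1) 1 := by
  intro v hv
  simp only [mem_Icc]
  constructor <;> intro i
  · by_cases hi : i ∈ T
    · exact (abs_lt.1 (hv.1 i hi).2).1.le
    · exact (abs_lt.1 (hv.2 i hi)).1.le
  · by_cases hi : i ∈ T
    · exact (abs_lt.1 (hv.1 i hi).2).2.le
    · exact (abs_lt.1 (hv.2 i hi)).2.le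

/-- The inner region is bounded. [cite: Viusos2020, Thm. 2.1 (arXiv:1509.01097 numbering)] -/
theorem isBounded_inner : Bornology.IsBounded (inner T) :=
  (isBounded_Icc (-1 : Fin n → ℝ) 1).subset (inner_subset_Icc T)

/-! ### Semialgebraicity of the regions -/

/-- `{|v i| < 1} = {0 < 1 - v_i²}` is `ℚ`-semialgebraic. [folklore] -/
theorem isSemialgebraic_setOf_abs_lt_one (i : Fin n) :
    IsSemialgebraic ℚ {v : Fin n → ℝ | |v i| < 1} := by
  convert isSemialgebraic_setOf_eval_pos (k := ℚ) (R := ℝ) (1 - X i ^ 2 : MvPolynomial (Fin n) ℚ)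
    using 1
  ext v
  simp only [mem_setOf_eq, map_sub, map_one, map_pow, aeval_X, sub_pos, sq_lt_one_iff_abs_lt_one]

/-- `{1 < |v i|} = {0 < v_i² - 1}` is `ℚ`-semialgebraic. [folklore] -/
theorem isSemialgebraic_setOf_one_lt_abs (i : Fin n) :
    IsSemialgebraic ℚ {v : Fin n → ℝ | 1 < |v i|} := by
  convert isSemialgebraic_setOf_eval_pos (k := ℚ) (R := ℝ) (X i ^ 2 - 1 : MvPolynomial (Fin n) ℚ)
    using 1
  ext v
  simp only [mem_setOf_eq, map_sub, map_one, map_pow, aeval_X, sub_pos, one_lt_sq_iff_one_lt_abs]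

/-- `{0 < |v i|} = {v_i ≠ 0}` is `ℚ`-semialgebraic. [folklore] -/
theorem isSemialgebraic_setOf_abs_pos (i : Fin n) :
    IsSemialgebraic ℚ {v : Fin n → ℝ | 0 < |v i|} := by
  convert isSemialgebraic_setOf_eval_ne_zero (k := ℚ) (R := ℝ) (X i : MvPolynomial (Fin n) ℚ)
    using 1
  ext v
  simp only [mem_setOf_eq, aeval_X, abs_pos, ne_eq]

/-- The outer regions are `ℚ`-semialgebraic.
[cite: Viusos2020, Thm. 2.1 (arXiv:1509.01097 numbering)] -/
theorem isSemialgebraic_outer : IsSemialgebraic ℚ (outer T) := by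
  have h1 : IsSemialgebraic ℚ (⋂ i ∈ T, {v : Fin n → ℝ | 1 < |v i|}) :=
    IsSemialgebraic.biInter T _ fun i _ => isSemialgebraic_setOf_one_lt_abs i
  have h2 : IsSemialgebraic ℚ (⋂ i ∈ Tᶜ, {v : Fin n → ℝ | |v i| < 1}) :=
    IsSemialgebraic.biInter Tᶜ _ fun i _ => isSemialgebraic_setOf_abs_lt_one i
  convert h1.inter h2 using 1
  ext v
  simp [outer, mem_iInter]

/-- The inner regions are `ℚ`-semialgebraic.
[cite: Viusos2020, Thm. 2.1 (arXiv:1509.01097 numbering)] -/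
theorem isSemialgebraic_inner : IsSemialgebraic ℚ (inner T) := by
  have h1 : IsSemialgebraic ℚ (⋂ i ∈ T, ({v : Fin n → ℝ | 0 < |v i|} ∩ {v | |v i| < 1})) :=
    IsSemialgebraic.biInter T _ fun i _ =>
      (isSemialgebraic_setOf_abs_pos i).inter (isSemialgebraic_setOf_abs_lt_one i)
  have h2 : IsSemialgebraic ℚ (⋂ i ∈ Tᶜ, {v : Fin n → ℝ | |v i| < 1}) :=
    IsSemialgebraic.biInter Tᶜ _ fun i _ => isSemialgebraic_setOf_abs_lt_one i
  convert h1.inter h2 using 1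
  ext v
  simp [inner, mem_iInter]

/-! ### Covering and disjointness of the outer regions -/

/-- A point off the hyperplanes `|y i| = 1` lies in the outer region of `T = {i | 1 < |y i|}`.
[cite: Viusos2020, Thm. 2.1 (arXiv:1509.01097 numbering)] -/
theorem mem_outer_filter {y : Fin n → ℝ} (hy : ∀ i, |y i| ≠ 1) :
    y ∈ outer (Finset.univ.filter fun i => 1 < |y i|) := by
  refine ⟨fun i hi => (Finset.mem_filter.1 hi).2, fun i hi => ?_⟩
  have : ¬ 1 < |y i| := fun h => hi (Finset.mem_filter.2 ⟨Finset.mem_univ _, h⟩)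
  exact lt_of_le_of_ne (not_lt.1 this) (hy i)

/-- The outer regions are pairwise disjoint.
[cite: Viusos2020, Thm. 2.1 (arXiv:1509.01097 numbering)] -/
theorem eq_of_mem_outer {T T' : Finset (Fin n)} {y : Fin n → ℝ} (hT : y ∈ outer T)
    (hT' : y ∈ outer T') : T = T' := by
  ext i
  constructor <;> intro hi <;> by_contra hi'
  · exact lt_asymm (hT.1 i hi) ((hT'.2 i hi').trans_le le_rfl)
  · exact lt_asymm (hT'.1 i hi) ((hT.2 i hi').trans_le le_rfl)

/-- The traces `σ ∩ outer T` are pairwise disjoint.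
[cite: Viusos2020, Thm. 2.1 (arXiv:1509.01097 numbering)] -/
theorem pairwiseDisjoint_outer (σ : Set (Fin n → ℝ)) :
    Set.Pairwise (↑(Finset.univ : Finset (Finset (Fin n)))) (Function.onFun Disjoint fun T => σ ∩ outer T) := by
  intro T _ T' _ hTT'
  refine disjoint_left.2 fun y hy hy' => hTT' (eq_of_mem_outer hy.2 hy'.2)

/-- The complement of the union of the outer regions is contained in the null set
`⋃ i, {y | |y i| = 1}` (coordinate hyperplanes are Lebesgue-null, `Measure.pi_hyperplane`).
[folklore] -/
theorem volume_compl_iUnion_outer :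
    volume (⋃ T : Finset (Fin n), outer T)ᶜ = 0 := by
  have hsub : (⋃ T : Finset (Fin n), outer T)ᶜ ⊆
      ⋃ i : Fin n, ({y : Fin n → ℝ | y i = 1} ∪ {y | y i = -1}) := by
    intro y hy
    by_contra h
    simp only [mem_iUnion, mem_union, mem_setOf_eq, not_exists, not_or] at h
    have hy1 : ∀ i, |y i| ≠ 1 := fun i h1 => by
      rcases abs_eq (zero_le_one' ℝ) |>.1 h1 with h2 | h2
      · exact (h i).1 h2
      · exact (h i).2 h2
    exact hy (mem_iUnion.2 ⟨_, mem_outer_filter hy1⟩)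
  refine measure_mono_null hsub ((measure_iUnion_null_iff).2 fun i => ?_)
  rw [measure_union_null_iff]
  constructor
  · rw [volume_pi]; exact Measure.pi_hyperplane (fun _ => volume) i 1
  · rw [volume_pi]; exact Measure.pi_hyperplane (fun _ => volume) i (-1)

/-- `σ` is, up to a Lebesgue-null set, the disjoint union of its traces on the outer regions.
[cite: Viusos2020, Thm. 2.1 (arXiv:1509.01097 numbering)] -/
theorem ae_eq_iUnion_inter_outer (σ : Set (Fin n → ℝ)) :
    (⋃ T ∈ (Finset.univ : Finset (Finset (Fin n))), σ ∩ outer T : Set (Fin n → ℝ)) =ᵐ[volume] σ := by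
  refine (ae_eq_set).2 ⟨?_, ?_⟩
  · rw [Set.sdiff_eq_empty.2]
    · exact measure_empty
    · exact iUnion₂_subset fun T _ => inter_subset_left
  · refine measure_mono_null ?_ volume_compl_iUnion_outer
    intro y hy
    rw [Set.mem_sdiff] at hy
    intro hy'
    obtain ⟨T, hT⟩ := mem_iUnion.1 hy'
    exact hy.2 (mem_iUnion₂.2 ⟨T, Finset.mem_univ T, hy.1, hT⟩)

/-! ### The derivative of the inversion and its determinant -/

/-- The derivative of `inv T` at `v`: the diagonal map with entries `-(v i ^ 2)⁻¹` (`i ∈ T`)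
and `1` (`i ∉ T`). [folklore] -/
def invDeriv (v : Fin n → ℝ) : (Fin n → ℝ) →L[ℝ] (Fin n → ℝ) :=
  ContinuousLinearMap.pi fun i =>
    (ContinuousLinearMap.toSpanSingleton ℝ (if i ∈ T then -((v i) ^ 2)⁻¹ else 1)).comp
      (ContinuousLinearMap.proj i)

/-- The determinant of the (diagonal) derivative of `inv T`. [folklore] -/
theorem det_invDeriv (v : Fin n → ℝ) :
    (invDeriv T v).det = ∏ i, (if i ∈ T then -((v i) ^ 2)⁻¹ else (1 : ℝ)) := by
  rw [invDeriv, ContinuousLinearMap.det_pi]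
  simp

/-- The Jacobian of `inv T`: `|det D(inv T)(v)| = ∏_{i ∈ T} v_i⁻²`. [folklore] -/
theorem abs_det_invDeriv (v : Fin n → ℝ) :
    |(invDeriv T v).det| = ∏ i ∈ T, ((v i) ^ 2)⁻¹ := by
  rw [det_invDeriv, Finset.abs_prod, ← Finset.prod_filter_mul_prod_filter_not Finset.univ (· ∈ T)]
  have h1 : (Finset.univ.filter fun i => i ∈ T) = T := by ext; simp
  have h2 : ∏ i ∈ Finset.univ.filter (fun i => ¬ i ∈ T),
      |(if i ∈ T then -((v i) ^ 2)⁻¹ else (1 : ℝ))| = 1 :=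
    Finset.prod_eq_one fun i hi => by simp [(Finset.mem_filter.1 hi).2]
  rw [h2, mul_one, h1]
  exact Finset.prod_congr rfl fun i hi => by simp [hi, abs_inv, abs_neg]

/-- `inv T` is differentiable off the coordinate hyperplanes of `T`, with derivative `invDeriv T v`.
[folklore] -/
theorem hasFDerivAt_invT {v : Fin n → ℝ} (hv : ∀ i ∈ T, v i ≠ 0) :
    HasFDerivAt (inv T) (invDeriv T v) v := by
  refine hasFDerivAt_pi'' fun i => ?_
  have hproj : (ContinuousLinearMap.proj i).comp (invDeriv T v) =
      (ContinuousLinearMap.toSpanSingleton ℝ (if i ∈ T then -((v i) ^ 2)⁻¹ else 1)).comp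
        (ContinuousLinearMap.proj i) := by
    ext w
    simp [invDeriv]
  rw [hproj]
  by_cases hi : i ∈ T
  · simp only [hi, if_true]
    have h1 : HasFDerivAt (fun w : Fin n → ℝ => w i) (ContinuousLinearMap.proj i) v :=
      hasFDerivAt_apply (𝕜 := ℝ) i v
    have h2 : HasFDerivAt (fun x : ℝ => x⁻¹)
        (ContinuousLinearMap.toSpanSingleton ℝ (-((v i) ^ 2)⁻¹)) (v i) :=
      _root_.hasFDerivAt_inv (hv i hi)
    have h := h2.comp v h1
    refine h.congr_of_eventuallyEq ?_
    exact Eventually.of_forall fun w => by simp [inv, hi]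
  · simp only [hi, if_false]
    have h : HasFDerivAt (fun w : Fin n → ℝ => w i) (ContinuousLinearMap.proj i) v :=
      hasFDerivAt_apply (𝕜 := ℝ) i v
    have : (ContinuousLinearMap.toSpanSingleton ℝ (1 : ℝ)).comp (ContinuousLinearMap.proj i) =
        (ContinuousLinearMap.proj i : (Fin n → ℝ) →L[ℝ] ℝ) := by
      ext w; simp
    rw [this]
    refine h.congr_of_eventuallyEq (Eventually.of_forall fun w => by simp [inv, hi])


/-! ### Reflected polynomials: `p ∘ inv T` cleared of denominators -/

/-- Reflection of an exponent vector in the coordinates of `T` at height `D`: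
`d ↦ (D - d i)` for `i ∈ T`, `d i` otherwise. [folklore] -/
def reflectExp (D : ℕ) (d : Fin n →₀ ℕ) : Fin n →₀ ℕ :=
  Finsupp.equivFunOnFinite.symm fun i => if i ∈ T then D - d i else d i

/-- Components of the reflected exponent. [folklore] -/
@[simp] theorem reflectExp_apply (D : ℕ) (d : Fin n →₀ ℕ) (i : Fin n) :
    reflectExp T D d i = if i ∈ T then D - d i else d i := by
  simp [reflectExp]

/-- The *reflected polynomial* `v ↦ (∏_{i ∈ T} v_i ^ D) · p (inv T v)`, for `D` at least the
exponents of `p` in the coordinates of `T`: its monomials are those of `p` with exponents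
reflected by `reflectExp T D`. It has the same (rational) coefficients as `p`. [folklore] -/
def reflect (D : ℕ) (p : MvPolynomial (Fin n) ℚ) : MvPolynomial (Fin n) ℚ :=
  ∑ d ∈ p.support, monomial (reflectExp T D d) (coeff d p)

/-- Every exponent occurring in `p` is at most the total degree of `p`. [folklore] -/
theorem exp_le_totalDegree {p : MvPolynomial (Fin n) ℚ} {d : Fin n →₀ ℕ} (hd : d ∈ p.support)
    (i : Fin n) : d i ≤ p.totalDegree :=
  (monomial_le_degreeOf i hd).trans (degreeOf_le_totalDegree p i)

/-- The monomial identity behind `aeval_reflect`: `v^(reflectExp d) = (∏_{i∈T} v_i^D) · (inv T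
v)^d`. [folklore] -/
theorem prod_pow_reflectExp {D : ℕ} {d : Fin n →₀ ℕ} (hD : ∀ i ∈ T, d i ≤ D) {v : Fin n → ℝ}
    (hv : ∀ i ∈ T, v i ≠ 0) :
    ∏ i, v i ^ reflectExp T D d i = (∏ i ∈ T, v i ^ D) * ∏ i, inv T v i ^ d i := by
  have h1 : ∀ i, v i ^ reflectExp T D d i = (if i ∈ T then v i ^ D else 1) * inv T v i ^ d i := by
    intro i
    by_cases hi : i ∈ T
    · rw [reflectExp_apply, if_pos hi, if_pos hi, inv_apply_of_mem T hi, inv_pow,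
        pow_sub₀ _ (hv i hi) (hD i hi)]
    · simp [hi]
  simp_rw [h1, Finset.prod_mul_distrib]
  congr 1
  rw [← Finset.prod_filter, Finset.filter_mem_eq_inter, Finset.univ_inter]

/-- **Evaluation of the reflected polynomial**: `(reflect T D p)(v) = (∏_{i ∈ T} v_i ^ D) · p (inv T
v)` whenever `D` bounds the exponents of `p` in the coordinates of `T` and these coordinates of `v`
are non-zero. [folklore] -/
theorem aeval_reflect {D : ℕ} {p : MvPolynomial (Fin n) ℚ} (hD : ∀ d ∈ p.support, ∀ i ∈ T, d i ≤ D)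
    {v : Fin n → ℝ} (hv : ∀ i ∈ T, v i ≠ 0) :
    aeval v (reflect T D p) = (∏ i ∈ T, v i ^ D) * aeval (inv T v) p := by
  conv_rhs => rw [p.as_sum]
  simp only [reflect, map_sum, Finset.mul_sum]
  refine Finset.sum_congr rfl fun d hd => ?_
  rw [aeval_monomial, aeval_monomial, Finsupp.prod_fintype _ _ (fun i => by simp),
    Finsupp.prod_fintype _ _ (fun i => by simp), prod_pow_reflectExp T (hD d hd) hv]
  ring

/-- `∏_{i ∈ T} v_i ^ D ≠ 0` when the coordinates in `T` are non-zero. [folklore] -/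
theorem prod_pow_ne_zero {D : ℕ} {v : Fin n → ℝ} (hv : ∀ i ∈ T, v i ≠ 0) :
    (∏ i ∈ T, v i ^ D) ≠ 0 :=
  Finset.prod_ne_zero_iff.2 fun i hi => pow_ne_zero _ (hv i hi)

/-- `∏_{i ∈ T} v_i ^ D > 0` for even `D` when the coordinates in `T` are non-zero. [folklore] -/
theorem prod_pow_pos {D : ℕ} (hD : Even D) {v : Fin n → ℝ} (hv : ∀ i ∈ T, v i ≠ 0) :
    0 < ∏ i ∈ T, v i ^ D :=
  Finset.prod_pos fun i hi => hD.pow_pos (hv i hi)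

/-! ### Semialgebraicity of the pulled-back domains -/

/-- For a `ℚ`-semialgebraic `s`, the part of `inv T ⁻¹' s` inside the inner region is
`ℚ`-semialgebraic: on generators `{p = 0}`, `{p > 0}` one clears denominators with an even power
(`aeval_reflect`), and the Boolean operations commute with `inner T ∩ inv T ⁻¹' (·)`
(no Tarski–Seidenberg needed). [cite: BochnakCosteRoy1998, §2.1] -/
theorem isSemialgebraic_inner_inter_preimage {s : Set (Fin n → ℝ)} (hs : IsSemialgebraic ℚ s) :
    IsSemialgebraic ℚ (inner T ∩ inv T ⁻¹' s) := by
  induction hs using BooleanSubalgebra.closure_bot_sup_induction with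
  | mem t ht =>
    rcases ht with ⟨g, rfl⟩ | ⟨g, rfl⟩
    · have hD : ∀ d ∈ g.support, ∀ i ∈ T, d i ≤ 2 * g.totalDegree := fun d hd i _ =>
        (exp_le_totalDegree hd i).trans (Nat.le_mul_of_pos_left _ two_pos)
      convert (isSemialgebraic_inner T).inter
        (isSemialgebraic_setOf_eval_eq_zero (k := ℚ) (R := ℝ) (reflect T (2 * g.totalDegree) g))
        using 1
      ext v
      simp only [mem_inter_iff, mem_preimage, mem_setOf_eq]
      refine and_congr_right fun hv => ?_
      have hv0 : ∀ i ∈ T, v i ≠ 0 := fun i hi => ne_zero_of_mem_inner T hv hi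
      rw [aeval_reflect T hD hv0, mul_eq_zero, or_iff_right (prod_pow_ne_zero T hv0)]
    · have hD : ∀ d ∈ g.support, ∀ i ∈ T, d i ≤ 2 * g.totalDegree := fun d hd i _ =>
        (exp_le_totalDegree hd i).trans (Nat.le_mul_of_pos_left _ two_pos)
      convert (isSemialgebraic_inner T).inter
        (isSemialgebraic_setOf_eval_pos (k := ℚ) (R := ℝ) (reflect T (2 * g.totalDegree) g))
        using 1
      ext v
      simp only [mem_inter_iff, mem_preimage, mem_setOf_eq]
      refine and_congr_right fun hv => ?_
      have hv0 : ∀ i ∈ T, v i ≠ 0 := fun i hi => ne_zero_of_mem_inner T hv hi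
      rw [aeval_reflect T hD hv0, mul_pos_iff_of_pos_left (prod_pow_pos T (even_two_mul _) hv0)]
  | bot => simp
  | sup t _ u _ iht ihu =>
    have : inner T ∩ inv T ⁻¹' (t ⊔ u) = (inner T ∩ inv T ⁻¹' t) ∪ (inner T ∩ inv T ⁻¹' u) := by
      change inner T ∩ inv T ⁻¹' (t ∪ u) = _
      rw [preimage_union, inter_union_distrib_left]
    rw [this]
    exact iht.union ihu
  | compl t _ iht =>
    have : inner T ∩ inv T ⁻¹' tᶜ = inner T \ (inner T ∩ inv T ⁻¹' t) := by
      ext v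
      simp only [mem_inter_iff, mem_preimage, mem_compl_iff, Set.mem_sdiff]
      tauto
    rw [this]
    exact (isSemialgebraic_inner T).diff iht

/-! ### The compactified pieces of `∫_σ p/q` -/

section Piece

variable (σ : Set (Fin n → ℝ)) (p q : MvPolynomial (Fin n) ℚ)

/-- The domain of the `T`-th piece: the pull-back of `σ ∩ outer T` by the inversion `inv T`.
[cite: Viusos2020, Thm. 2.1 (arXiv:1509.01097 numbering)] -/
def pieceDom : Set (Fin n → ℝ) := inner T ∩ inv T ⁻¹' σ

/-- A common bound for the exponents of `p` and `q`. [folklore] -/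
def degBound : ℕ := p.totalDegree + q.totalDegree

/-- Numerator of the `T`-th piece: the reflected `p`.
[cite: Viusos2020, Thm. 2.1 (arXiv:1509.01097 numbering)] -/
def pieceNum : MvPolynomial (Fin n) ℚ := reflect T (degBound p q) p

/-- Denominator of the `T`-th piece: the reflected `q` times the Jacobian factor
`∏_{i ∈ T} X_i ^ 2`. [cite: Viusos2020, Thm. 2.1 (arXiv:1509.01097 numbering)] -/
def pieceDen : MvPolynomial (Fin n) ℚ := reflect T (degBound p q) q * ∏ i ∈ T, X i ^ 2

variable {σ p q}

/-- The piece domain lies in the inner region.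
[cite: Viusos2020, Thm. 2.1 (arXiv:1509.01097 numbering)] -/
theorem pieceDom_subset_inner : pieceDom T σ ⊆ inner T := inter_subset_left

/-- **The piece domains are bounded.** [cite: Viusos2020, Thm. 2.1 (arXiv:1509.01097 numbering)] -/
theorem isBounded_pieceDom : Bornology.IsBounded (pieceDom T σ) :=
  (isBounded_inner T).subset (pieceDom_subset_inner T)

/-- The piece domains lie in the cube `[-1, 1]ⁿ`.
[cite: Viusos2020, Thm. 2.1 (arXiv:1509.01097 numbering)] -/
theorem pieceDom_subset_Icc : pieceDom T σ ⊆ Icc (-1) 1 :=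
  (pieceDom_subset_inner T).trans (inner_subset_Icc T)

/-- The piece domains are `ℚ`-semialgebraic.
[cite: Viusos2020, Thm. 2.1 (arXiv:1509.01097 numbering)] -/
theorem isSemialgebraic_pieceDom (hσ : IsSemialgebraic ℚ σ) : IsSemialgebraic ℚ (pieceDom T σ) :=
  isSemialgebraic_inner_inter_preimage T hσ

/-- `inv T` maps the `T`-th piece domain onto `σ ∩ outer T`.
[cite: Viusos2020, Thm. 2.1 (arXiv:1509.01097 numbering)] -/
theorem image_inv_pieceDom : inv T '' pieceDom T σ = σ ∩ outer T := image_inv_inter T σ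

/-- The piece domains are measurable. [cite: Viusos2020, Thm. 2.1 (arXiv:1509.01097 numbering)] -/
theorem measurableSet_pieceDom (hσ : IsSemialgebraic ℚ σ) : MeasurableSet (pieceDom T σ) :=
  IsSemialgebraic.measurableSet_holds (isSemialgebraic_pieceDom T hσ)

/-- `degBound p q` bounds the exponents of `p`. [folklore] -/
theorem degBound_left : ∀ d ∈ p.support, ∀ i ∈ T, d i ≤ degBound p q :=
  fun _ hd i _ => (exp_le_totalDegree hd i).trans (Nat.le_add_right _ _)

/-- `degBound p q` bounds the exponents of `q`. [folklore] -/
theorem degBound_right : ∀ d ∈ q.support, ∀ i ∈ T, d i ≤ degBound p q :=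
  fun _ hd i _ => (exp_le_totalDegree hd i).trans (Nat.le_add_left _ _)

/-- Evaluation of the Jacobian factor `∏_{i ∈ T} X_i ^ 2`. [folklore] -/
theorem aeval_prod_X_sq (v : Fin n → ℝ) :
    aeval v (∏ i ∈ T, X i ^ 2 : MvPolynomial (Fin n) ℚ) = ∏ i ∈ T, v i ^ 2 := by
  simp [map_prod]

/-- On the piece domain the denominator does not vanish.
[cite: Viusos2020, Thm. 2.1 (arXiv:1509.01097 numbering)] -/
theorem pieceDen_ne_zero (hq : ∀ y ∈ σ, aeval y q ≠ 0) :
    ∀ v ∈ pieceDom T σ, aeval v (pieceDen T p q) ≠ 0 := by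
  intro v hv
  have hv0 : ∀ i ∈ T, v i ≠ 0 := fun i hi => ne_zero_of_mem_inner T hv.1 hi
  rw [pieceDen, map_mul, aeval_prod_X_sq, aeval_reflect T (degBound_right T) hv0]
  exact mul_ne_zero (mul_ne_zero (prod_pow_ne_zero T hv0) (hq _ hv.2)) (prod_pow_ne_zero T hv0)

/-- On the piece domain, the Jacobian-weighted pull-back of `p/q` is `pieceNum / pieceDen`.
[cite: Viusos2020, Thm. 2.1 (arXiv:1509.01097 numbering)] -/
theorem integrand_piece_eq (hq : ∀ y ∈ σ, aeval y q ≠ 0) {v : Fin n → ℝ} (hv : v ∈ pieceDom T σ) :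
    |(invDeriv T v).det| * (aeval (inv T v) p / aeval (inv T v) q) =
      aeval v (pieceNum T p q) / aeval v (pieceDen T p q) := by
  have hv0 : ∀ i ∈ T, v i ≠ 0 := fun i hi => ne_zero_of_mem_inner T hv.1 hi
  have hP : (∏ i ∈ T, v i ^ degBound p q) ≠ 0 := prod_pow_ne_zero T hv0
  have hJ : (∏ i ∈ T, v i ^ 2) ≠ 0 := prod_pow_ne_zero T hv0
  have hqv : aeval (inv T v) q ≠ 0 := hq _ hv.2
  rw [abs_det_invDeriv, pieceNum, pieceDen, map_mul, aeval_prod_X_sq,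
    aeval_reflect T (degBound_left T) hv0, aeval_reflect T (degBound_right T) hv0,
    Finset.prod_inv_distrib]
  field_simp

/-- `inv T` is differentiable within the piece domain.
[cite: Viusos2020, Thm. 2.1 (arXiv:1509.01097 numbering)] -/
theorem hasFDerivWithinAt_inv_pieceDom :
    ∀ v ∈ pieceDom T σ, HasFDerivWithinAt (inv T) (invDeriv T v) (pieceDom T σ) v :=
  fun _ hv => (hasFDerivAt_invT T fun _ hi => ne_zero_of_mem_inner T hv.1 hi).hasFDerivWithinAt

/-- `inv T` is injective on the piece domain.
[cite: Viusos2020, Thm. 2.1 (arXiv:1509.01097 numbering)] -/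
theorem injOn_inv_pieceDom : InjOn (inv T) (pieceDom T σ) := (inv_injective T).injOn

/-- Absolute convergence of the `T`-th piece (Mathlib's
`integrableOn_image_iff_integrableOn_abs_det_fderiv_smul`).
[cite: Viusos2020, Thm. 2.1 (arXiv:1509.01097 numbering)] -/
theorem integrableOn_piece (hσ : IsSemialgebraic ℚ σ) (hq : ∀ y ∈ σ, aeval y q ≠ 0)
    (hint : IntegrableOn (fun y => aeval y p / aeval y q) σ) :
    IntegrableOn (fun v => aeval v (pieceNum T p q) / aeval v (pieceDen T p q)) (pieceDom T σ) := by
  have h := (integrableOn_image_iff_integrableOn_abs_det_fderiv_smul volume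
    (measurableSet_pieceDom T hσ) (hasFDerivWithinAt_inv_pieceDom T) (injOn_inv_pieceDom T)
    (fun y => aeval y p / aeval y q)).1 (by
      rw [image_inv_pieceDom]
      exact hint.mono_set inter_subset_left)
  refine h.congr_fun (fun v hv => ?_) (measurableSet_pieceDom T hσ)
  simp only [smul_eq_mul]
  exact integrand_piece_eq T hq hv

/-- **Change of variables for the `T`-th piece** (Mathlib's Jacobian formula
`integral_image_eq_integral_abs_det_fderiv_smul`):
`∫_{pieceDom T σ} pieceNum/pieceDen = ∫_{σ ∩ outer T} p/q`.
[cite: Viusos2020, Thm. 2.1 (arXiv:1509.01097 numbering)] -/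
theorem integral_piece (hσ : IsSemialgebraic ℚ σ) (hq : ∀ y ∈ σ, aeval y q ≠ 0) :
    ∫ v in pieceDom T σ, aeval v (pieceNum T p q) / aeval v (pieceDen T p q) =
      ∫ y in σ ∩ outer T, aeval y p / aeval y q := by
  rw [← image_inv_pieceDom,
    integral_image_eq_integral_abs_det_fderiv_smul volume (measurableSet_pieceDom T hσ)
      (hasFDerivWithinAt_inv_pieceDom T) (injOn_inv_pieceDom T)]
  refine setIntegral_congr_fun (measurableSet_pieceDom T hσ) fun v hv => ?_
  simp only [smul_eq_mul]
  exact (integrand_piece_eq T hq hv).symm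

end Piece

end PeriodCompactify

/-! ### Main results -/

section Main

open PeriodCompactify

variable {n : ℕ} {σ : Set (Fin n → ℝ)} {p q : MvPolynomial (Fin n) ℚ}

/-- **Decomposition of `∫_σ p/q` into integrals over bounded domains** (Viu-Sos 2021, Thm. 2.1,
for the naive rational data of Kontsevich–Zagier): up to the null set `⋃ᵢ {|yᵢ| = 1}`, `ℝⁿ` is the
disjoint union of the `2ⁿ` outer regions, and on each of them the coordinate inversion `inv T`
is a chart with bounded source `pieceDom T σ ⊆ [-1, 1]ⁿ`, rational inverse and rational Jacobian.
[cite: Viusos2020, Thm. 2.1] -/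
theorem setIntegral_eq_sum_integral_piece (hσ : IsSemialgebraic ℚ σ) (hq : ∀ y ∈ σ, aeval y q ≠ 0)
    (hint : IntegrableOn (fun y => aeval y p / aeval y q) σ) :
    ∫ y in σ, aeval y p / aeval y q =
      ∑ T : Finset (Fin n), ∫ v in pieceDom T σ, aeval v (pieceNum T p q) / aeval v (pieceDen T p q) := by
  simp_rw [integral_piece _ hσ hq]
  have hσm : MeasurableSet σ := IsSemialgebraic.measurableSet_holds hσ
  rw [← integral_biUnion_finset Finset.univ (fun T _ => hσm.inter
      (IsSemialgebraic.measurableSet_holds (isSemialgebraic_outer T))) (pairwiseDisjoint_outer σ)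
      (fun T _ => hint.mono_set inter_subset_left)]
  exact (setIntegral_congr_set (ae_eq_iUnion_inter_outer σ)).symm

/-- **Real periods are finite sums of absolutely convergent integrals over bounded domains**
(Viu-Sos 2021, Thm. 2.1 / Cor. 2.1, "compact domains", for the naive `ℚ`-definition of
Kontsevich–Zagier): every real period `x` is `∑_T ∫_{σ_T} p_T/q_T` with `σ_T ⊆ [-1, 1]ⁿ`
`ℚ`-semialgebraic, `p_T, q_T ∈ ℚ[x₁, …, xₙ]`, `q_T ≠ 0` on `σ_T` and `p_T/q_T ∈ L¹(σ_T)`.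
[cite: Viusos2020, Thm. 2.1 and Cor. 2.1] -/
theorem IsRealPeriod.exists_eq_sum_setIntegral_bounded {x : ℝ} (hx : IsRealPeriod x) :
    ∃ (n : ℕ) (τ : Finset (Fin n) → Set (Fin n → ℝ))
      (a b : Finset (Fin n) → MvPolynomial (Fin n) ℚ),
      (∀ T, IsSemialgebraic ℚ (τ T) ∧ τ T ⊆ Icc (-1) 1 ∧ (∀ y ∈ τ T, aeval y (b T) ≠ 0) ∧
        IntegrableOn (fun y => aeval y (a T) / aeval y (b T)) (τ T)) ∧
      x = ∑ T, ∫ y in τ T, aeval y (a T) / aeval y (b T) := by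
  obtain ⟨n, σ, p, q, hσ, hq, hint, rfl⟩ := hx
  exact ⟨n, fun T => pieceDom T σ, fun T => pieceNum T p q, fun T => pieceDen T p q,
    fun T => ⟨isSemialgebraic_pieceDom T hσ, pieceDom_subset_Icc T, pieceDen_ne_zero T hq,
      integrableOn_piece T hσ hq hint⟩,
    setIntegral_eq_sum_integral_piece hσ hq hint⟩

/-- The same decomposition inside the KZ calculus: every real period is the sum of the values of
`2ⁿ` integral representations of KZ's literal (rational) shape with domains in `[-1, 1]ⁿ`.
[cite: Viusos2020, Thm. 2.1 and Cor. 2.1] -/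
theorem IsRealPeriod.exists_eq_sum_value_bounded {x : ℝ} (hx : IsRealPeriod x) :
    ∃ (n : ℕ) (r : Finset (Fin n) → KZ.IntegralRep n),
      (∀ T, (r T).IsRational ∧ (r T).domain ⊆ Icc (-1) 1) ∧ x = ∑ T, (r T).value := by
  obtain ⟨n, σ, p, q, hσ, hq, hint, rfl⟩ := hx
  refine ⟨n, fun T => KZ.IntegralRep.ofRational (pieceDom T σ) (pieceNum T p q) (pieceDen T p q)
    (isSemialgebraic_pieceDom T hσ) (pieceDen_ne_zero T hq) (integrableOn_piece T hσ hq hint),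
    fun T => ⟨KZ.IntegralRep.isRational_ofRational _ _ _ _ _ _, pieceDom_subset_Icc T⟩, ?_⟩
  simpa using setIntegral_eq_sum_integral_piece hσ hq hint

end Main

/-! ### Yoshinaga's computability facts from separation of poles on bounded domains -/

section SeparationOfPoles

open PeriodCompactify Literature.Computability.Complexity

/-- Finite sums of computable reals are computable (Weihrauch 2000, Thm. 4.3.2, iterated).
[cite: Weihrauch2000, Thm. 4.3.2] -/
theorem isComputableReal_finset_sum {ι : Type*} (s : Finset ι) (f : ι → ℝ)
    (h : ∀ i ∈ s, IsComputableReal (f i)) : IsComputableReal (∑ i ∈ s, f i) := by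
  classical
  induction s using Finset.induction_on with
  | empty => simpa using IsComputableReal.ratCast_holds 0
  | insert a s ha ih =>
    rw [Finset.sum_insert ha]
    exact IsComputableReal.add_holds (h a (Finset.mem_insert_self a s))
      (ih fun i hi => h i (Finset.mem_insert_of_mem hi))

/-- **Real periods are computable, granted separation of poles on bounded domains.**
Hypothesis `H` is Viu-Sos' Cor. 2.2 (with Prop. 2.2: Hironaka's embedded resolution of the
Zariski closure of `∂S ∪ {P = 0} ∪ {Q = 0}` separates the pole locus of the pulled-back form from
the strict transform of `S`) for `ℚ`-data: an absolutely convergent `∫_σ p/q` over a *bounded*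
`ℚ`-semialgebraic `σ` is a finite sum of values of integral representations with bounded domain
and bounded integrand. Granted `H`, every real period is computable: reduce to bounded domains by
`IsRealPeriod.exists_eq_sum_setIntegral_bounded` (this file), apply `H`, and conclude by
`KZ.IntegralRep.isComputableReal_value_of_bounded` (volumes of bounded `ℚ`-semialgebraic sets
are computable) and closure of computable reals under finite sums. `H` is an explicit hypothesis,
not a named fact. [cite: Viusos2020, Prop. 2.2 and Cor. 2.2 (arXiv:1509.01097 numbering)] -/
theorem isComputableReal_of_isRealPeriod_of_separationOfPoles
    (H : ∀ (n : ℕ) (σ : Set (Fin n → ℝ)) (p q : MvPolynomial (Fin n) ℚ),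
      IsSemialgebraic ℚ σ → Bornology.IsBounded σ → (∀ y ∈ σ, aeval y q ≠ 0) →
      IntegrableOn (fun y => aeval y p / aeval y q) σ →
      ∃ (k : ℕ) (m : Fin k → ℕ) (r : ∀ j, KZ.IntegralRep (m j)),
        (∀ j, Bornology.IsBounded (r j).domain ∧
          ∃ M : ℝ, ∀ y ∈ (r j).domain, |(r j).integrand y| ≤ M) ∧
        ∫ y in σ, aeval y p / aeval y q = ∑ j, (r j).value) :
    isComputableReal_of_isRealPeriod := by
  intro x hx
  obtain ⟨n, τ, a, b, hτ, rfl⟩ := hx.exists_eq_sum_setIntegral_bounded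
  refine isComputableReal_finset_sum _ _ fun T _ => ?_
  obtain ⟨hs, hIcc, hb, hint⟩ := hτ T
  obtain ⟨k, m, r, hr, heq⟩ :=
    H n (τ T) (a T) (b T) hs ((isBounded_Icc (-1 : Fin n → ℝ) 1).subset hIcc) hb hint
  rw [heq]
  exact isComputableReal_finset_sum _ _ fun j _ =>
    (r j).isComputableReal_value_of_bounded (hr j).1 (hr j).2

/-- **Periods are computable complex numbers, granted separation of poles on bounded domains**
(complex form of the previous theorem: a period has real periods as real and imaginary parts).
[cite: Viusos2020, Prop. 2.2 and Cor. 2.2 (arXiv:1509.01097 numbering)] -/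
theorem isComputableComplex_of_isPeriod_of_separationOfPoles
    (H : ∀ (n : ℕ) (σ : Set (Fin n → ℝ)) (p q : MvPolynomial (Fin n) ℚ),
      IsSemialgebraic ℚ σ → Bornology.IsBounded σ → (∀ y ∈ σ, aeval y q ≠ 0) →
      IntegrableOn (fun y => aeval y p / aeval y q) σ →
      ∃ (k : ℕ) (m : Fin k → ℕ) (r : ∀ j, KZ.IntegralRep (m j)),
        (∀ j, Bornology.IsBounded (r j).domain ∧
          ∃ M : ℝ, ∀ y ∈ (r j).domain, |(r j).integrand y| ≤ M) ∧
        ∫ y in σ, aeval y p / aeval y q = ∑ j, (r j).value) :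
    isComputableComplex_of_isPeriod := fun hz =>
  ⟨isComputableReal_of_isRealPeriod_of_separationOfPoles H hz.1,
    isComputableReal_of_isRealPeriod_of_separationOfPoles H hz.2⟩

end SeparationOfPoles

end Literature.NumberTheory.Transcendental
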